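import Literature.Probability.FitznerVanDerHofstad2017.SawCountKernelG
import HarnessLib

set_option Elab.async false  -- one kernel evaluation at a time (bounded memory on the farm)

/-!
# Kernel-certified SAW end-point counts `c_n(x)` on `ℤ^d`, uniformly in `d` — `c_13(x)`, `x ∼ (1,4)` (beyond the published table) — part 13/14

Continuation of `SawCountTables` by the second kernel machine `sawCodeG` of `SawCountKernelG` (same recursion,
last two levels in closed form; see there for the method, the transfer theorem `sawCount_eq_sum_sawCodeG` and
the references): the 13-step class `x ∼ (1,4)`. Part 13 of 14: self-contained kernel pieces (leaf evaluations of `sawCodeG`) only — the parts a, b, c, d, e, f, g, h, i, j, k, l, m are independent of each other; part n assembles them into the theorem.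
Each coefficient is a sum of `decide +kernel` evaluations of `sawCodeG`, split along the recursion by
`sawCodeG_succ_expand`; no facts, no hypotheses beyond `s ≤ d`; no cell of the record is touched.
-/

namespace Literature.Probability.FitznerVanDerHofstad2017

open Finset Literature.Probability.LatticeModels Literature.Probability.Percolation

variable {d : ℕ}

/-! #### Kernel pieces for `card_sawWordsTo_n13_x14` (part 13) -/

set_option maxHeartbeats 0 in
/-- Kernel piece (child, 12375 calls). [folklore] -/
theorem card_sawWordsTo_n13_x14_g1032 : gMinus 10 2 4 628794940589399504710932769 7 (nextV 628794940589399504710670625 (nextV 628794940589399504710666529 0)) [628794940589399504710670625, 628794940589399504710666529] 2 = 10750 := by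
  decide +kernel

/-- Still-born child. [folklore] -/
theorem card_sawWordsTo_n13_x14_g1033 : gPlus 10 2 4 628794940589399504710932769 7 (nextV 628794940589399504710670625 (nextV 628794940589399504710666529 0)) [628794940589399504710670625, 628794940589399504710666529] 3 = 0 := by
  decide +kernel

/-- Kernel piece (child, 1 calls). [folklore] -/
theorem card_sawWordsTo_n13_x14_g1034 : gMinus 10 2 4 628794940589399504710932769 7 (nextV 628794940589399504710670625 (nextV 628794940589399504710666529 0)) [628794940589399504710670625, 628794940589399504710666529] 3 = 0 := by
  decide +kernel

set_option maxHeartbeats 0 in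
/-- Kernel piece (child, 54930 calls). [folklore] -/
theorem card_sawWordsTo_n13_x14_g1035 : gFresh 10 2 4 628794940589399504710932769 7 (nextV 628794940589399504710670625 (nextV 628794940589399504710666529 0)) [628794940589399504710670625, 628794940589399504710666529] = 53300 := by
  decide +kernel

end Literature.Probability.FitznerVanDerHofstad2017
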